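import Summits.Parity.BatemanHorn.Theses.VanishingDimension
import Literature.NumberTheory.Sieve.BatemanHornProofs

/-!
# Ideator-1 sketch (round 1) — crux `TiltCalibration` (stmt-Parity-18604, route-Parity-VanishingDimension, rank 3)

Typed companions of `Cruxes/TiltCalibration/LeversRejected-ideator1-r1.md` (crux-ideate round 1, ideator 1,
planner-cruxidea-stmt-Parity-18604-1-0, 2026-08-17). Nothing here is an item of the route and no line is
registered; the crux is referenced BY NAME, and the strategist's typed cells
(`Strategist.cellPred / PrimeCellCalibration / OffCellNegligible`, `Cruxes/TiltCalibration/StrategistSketch.lean`)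
are reused: `cellPred` and `OffCellNegligible` below are VERBATIM copies (the `Cruxes/` module is not part of the farm
build, so it cannot be imported; the copies are syntactically identical, hence interchangeable by `Iff.rfl`-grade glue).

* §1 `locPred`, `TopScalePrimeCofactorLaw` (the crux's open content pushed to the TOP scale: under the tilt the
  `x^θ`-rough part of every `fᵢ(n)` is ONE prime power and the smooth cofactor is `≤ x^{ε₀}`, for an
  ARBITRARY fixed `ε₀ ∈ (0, θ]`), `PrimeCellLocalisation` (PROVABLE-grade, L: the non-localised part of the
  prime cell has calibrated tilted mass `≤ B·z·(1 + log(θ/ε₀))` — the "`(ε₀/θ)^{kz}`-law" of the tilted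
  smooth part; numerics `numerics/out_4e6.txt`), and the two PROVED glues
  `tiltCalibration_of_topScale : OffCellNegligible → PrimeCellLocalisation → TopScalePrimeCofactorLaw → TiltCalibration`,
  `topScale_of_tiltCalibration : OffCellNegligible → PrimeCellLocalisation → TiltCalibration → TopScalePrimeCofactorLaw`:
  modulo two sieve-upper-bound lemmas the crux IS the prime-cofactor law at exponent `deg fᵢ − ε₀`, every `ε₀ > 0`
  (record §1: this sharpens the strategist's NECESSARY shadow `PrimeCellLowerBound` / `LargePrimeFactorThreeHalves`
  into an EQUIVALENT core at the conjectural endpoint exponent).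
* §2 `TiltedMassOrderUpper` (PROVABLE, refined Nair–Tenenbaum: `Φ_x(z) ≤ B`), `TiltedMassOrderLowerCrude`
  (PROVABLE, fundamental lemma on tilted smooth parts: `Φ_x(z) ≥ c·z^r`), `PrimeCellPositiveShare` (the ORDER
  statement `Φ_x(z) ≥ c₀ > 0` uniformly as `z → 0⁺`; record §1(b): already equivalent to producing
  `fᵢ(n) = (cofactor ≤ x^{ε₀})·prime` for `≫ x(log x)^{k(z-1)}` integers — for `X²+1` the Chebyshev–Hooley
  problem at exponent `2 − ε₀` with full logarithmic multiplicity, print `1.3`), with the PROVED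
  `primeCellPositiveShare_of : TiltCalibration → PrimeCellPositiveShare`.
* §3 `LargePrimeFactorTopScale` (the `X²+1` unpacking at exponent `2 − η`, every `η > 0`; typed only).
-/

noncomputable section

namespace Summit.Parity.BatemanHorn.Cruxes.TiltCalibration.Ideator1

open scoped BigOperators Classical
open Filter Finset Summit.Parity.BatemanHorn.Theses.VanishingDimension

/-! ## §0 Verbatim copies of the strategist's cells (`Cruxes/TiltCalibration/StrategistSketch.lean` §1) -/

/-- [verbatim copy of `Strategist.cellPred`] The prime-cell predicate at level `x^θ`: every `fᵢ(n)` has EXACTLY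
ONE prime factor `p ≥ ⌊x^θ⌋₊` (counted without multiplicity), i.e. its `x^θ`-rough part is a prime power. -/
def cellPred {k : ℕ} (f : Fin k → Polynomial ℤ) (θ : ℝ) (x n : ℕ) : Prop :=
  ∀ i, ((((f i).eval (n : ℤ)).toNat.primeFactors).filter (fun p : ℕ => ⌊(x : ℝ) ^ θ⌋₊ ≤ p)).card = 1

/-- [verbatim copy of `Strategist.OffCellNegligible`] PROVABLE piece of the cell split (sieve UPPER bounds only):
after calibration, the tilted mass OFF the prime cell is eventually at most `ε`, for all `z < z₂(f, θ, ε)`. -/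
def OffCellNegligible : Prop :=
  ∀ (k : ℕ) (f : Fin k → Polynomial ℤ), Literature.NumberTheory.Sieve.IsBatemanHornSystem f →
    ∀ θ : ℝ, 0 < θ → θ ≤ 1 / 4 → ∀ ε : ℝ, 0 < ε → ∃ z₂ : ℝ, 0 < z₂ ∧ ∀ z : ℝ, 0 < z → z < z₂ →
      let w : ℕ → ℝ := fun n => z ^ (∑ i, ArithmeticFunction.cardDistinctFactors (((f i).eval (n : ℤ)).toNat))
      let cnt : ℕ → ℕ → ℕ := fun p s => (Finset.univ.filter (fun i => (p : ℤ) ∣ (f i).eval (s : ℤ))).card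
      let m : ℕ → ℝ := fun p => ∑ s ∈ Finset.range p, z ^ cnt p s
      let V : ℕ → ℝ := fun x => ∏ p ∈ (Finset.range ⌊(x : ℝ) ^ θ⌋₊).filter Nat.Prime,
        ((p : ℝ) - Literature.NumberTheory.Sieve.polyRootCountMod f p) / m p
      ∀ᶠ x : ℕ in atTop,
        |Real.log x ^ k * (∑ n ∈ (Finset.Icc 1 x).filter (fun n : ℕ => ¬ cellPred f θ x n), w n) * V x /
            (z ^ k * (x : ℝ))| ≤ ε

/-! ## §1 The top-scale core: localised prime cell -/

/-- Localisation predicate (cofactor bound `x^{ε₀}`): every `fᵢ(n)` factors as `a · p^v` with `p` prime,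
`p ≥ ⌊x^θ⌋₊`, `p ∤ a`, `v ≥ 1` and `a ≤ x^{ε₀}` — i.e. its `x^θ`-rough part is ONE prime power and the smooth
cofactor is at most `x^{ε₀}` (so the prime is `≥ fᵢ(n)^{1/v}·x^{-ε₀/v}`, exponent `deg fᵢ − ε₀` when `v = 1`). -/
def locPred {k : ℕ} (f : Fin k → Polynomial ℤ) (θ ε₀ : ℝ) (x n : ℕ) : Prop :=
  ∀ i, ∃ a p v : ℕ, p.Prime ∧ ⌊(x : ℝ) ^ θ⌋₊ ≤ p ∧ ¬ p ∣ a ∧ 1 ≤ v ∧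
    ((f i).eval (n : ℤ)).toNat = a * p ^ v ∧ (a : ℝ) ≤ (x : ℝ) ^ ε₀

/-- THE CORE AT THE TOP SCALE. For every fixed cofactor exponent `ε₀ ∈ (0, θ]`: the calibrated tilted mass of
the LOCALISED prime cell (prime cell of the strategist's split ∧ `locPred`) has the crux's double limit
`C(f)/∏ deg fᵢ`. Heuristically its `x`-limit is `(C/∏d)·(ε₀/θ)^{kz}·(1 + O(z)) → C/∏d` (`z → 0⁺`), so the
statement is consistent for EVERY fixed `ε₀`; in words it is Bateman–Horn for the divided family
`g_{a,r}(m) = fᵢ(am+r)/a`, `a ≤ x^{ε₀}`, averaged with the multiplicative weights `z^{ω(a)}`, WITH CONSTANT —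
prime values of the `fᵢ` up to a cofactor `x^{ε₀}`, i.e. the Chebyshev–Hooley problem at exponent
`deg fᵢ − ε₀` with asymptotics. Summit-class for every member with `Σ deg ≥ 2` (record §1–§2). -/
def TopScalePrimeCofactorLaw : Prop :=
  ∀ (k : ℕ) (f : Fin k → Polynomial ℤ), Literature.NumberTheory.Sieve.IsBatemanHornSystem f →
    ∀ θ : ℝ, 0 < θ → θ ≤ 1 / 4 → ∀ ε₀ : ℝ, 0 < ε₀ → ε₀ ≤ θ → ∀ ε : ℝ, 0 < ε →
      ∃ z₂ : ℝ, 0 < z₂ ∧ ∀ z : ℝ, 0 < z → z < z₂ →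
      let w : ℕ → ℝ := fun n => z ^ (∑ i, ArithmeticFunction.cardDistinctFactors (((f i).eval (n : ℤ)).toNat))
      let cnt : ℕ → ℕ → ℕ := fun p s => (Finset.univ.filter (fun i => (p : ℤ) ∣ (f i).eval (s : ℤ))).card
      let m : ℕ → ℝ := fun p => ∑ s ∈ Finset.range p, z ^ cnt p s
      let V : ℕ → ℝ := fun x => ∏ p ∈ (Finset.range ⌊(x : ℝ) ^ θ⌋₊).filter Nat.Prime,
        ((p : ℝ) - Literature.NumberTheory.Sieve.polyRootCountMod f p) / m p
      ∀ᶠ x : ℕ in atTop,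
        |Real.log x ^ k *
            (∑ n ∈ ((Finset.Icc 1 x).filter (fun n : ℕ => cellPred f θ x n)).filter
                (fun n : ℕ => locPred f θ ε₀ x n), w n) * V x / (z ^ k * (x : ℝ)) -
          Literature.NumberTheory.Sieve.batemanHornConst f / ∏ i, ((f i).natDegree : ℝ)| ≤ ε

/-- PROVABLE (L): the `(ε₀/θ)^{kz}`-localisation of the prime cell. There is `B = B(f, θ)` such that for every
`ε₀ ∈ (0, θ]`, all small `z` and eventually in `x`, the calibrated tilted mass of the NON-localised part of the
prime cell (some smooth cofactor `> x^{ε₀}`) is at most `B·z·(1 + log(θ/ε₀))`. Route: drop primality of the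
rough part (upper-bound sieve / fundamental lemma for `{n : a ∣ fᵢ(n), fᵢ(n)/a is x^θ-rough}` uniformly in
`a ≤ x^{1/2}`, Rankin beyond), then the tilted harmonic measure `z^{ω(a)}ρ(a)/a` of `x^θ`-smooth `a > x^{ε₀}`
is a fraction `≤ 1 − (ε₀/θ)^{z}(1 − O(z)) ≤ z log(θ/ε₀) + O(z)` of `∏_{p<x^θ}(1 + zρ(p)/p)` per coordinate.
Numerics (`X²+1`, `x = 4·10⁶`, `θ = 1/4`): prime-cell share with `a ≤ x^u` = 0.927/0.958/0.987 at
`u = 0.15/0.2/0.25`, `z = 0.1`, against the model `(u/θ)^z e^{-γz}/Γ(1+z)` = 0.943/0.970/0.992. -/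
def PrimeCellLocalisation : Prop :=
  ∀ (k : ℕ) (f : Fin k → Polynomial ℤ), Literature.NumberTheory.Sieve.IsBatemanHornSystem f →
    ∀ θ : ℝ, 0 < θ → θ ≤ 1 / 4 → ∃ B : ℝ, ∀ ε₀ : ℝ, 0 < ε₀ → ε₀ ≤ θ →
      ∃ z₂ : ℝ, 0 < z₂ ∧ ∀ z : ℝ, 0 < z → z < z₂ →
      let w : ℕ → ℝ := fun n => z ^ (∑ i, ArithmeticFunction.cardDistinctFactors (((f i).eval (n : ℤ)).toNat))
      let cnt : ℕ → ℕ → ℕ := fun p s => (Finset.univ.filter (fun i => (p : ℤ) ∣ (f i).eval (s : ℤ))).card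
      let m : ℕ → ℝ := fun p => ∑ s ∈ Finset.range p, z ^ cnt p s
      let V : ℕ → ℝ := fun x => ∏ p ∈ (Finset.range ⌊(x : ℝ) ^ θ⌋₊).filter Nat.Prime,
        ((p : ℝ) - Literature.NumberTheory.Sieve.polyRootCountMod f p) / m p
      ∀ᶠ x : ℕ in atTop,
        |Real.log x ^ k *
            (∑ n ∈ ((Finset.Icc 1 x).filter (fun n : ℕ => cellPred f θ x n)).filter
                (fun n : ℕ => ¬ locPred f θ ε₀ x n), w n) * V x / (z ^ k * (x : ℝ))|
          ≤ B * z * (1 + Real.log (θ / ε₀))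

/-- PROVED glue (ε/3): off-cell bound + localisation + top-scale core ⇒ the crux. Uses the localisation only
at `ε₀ = θ` (bound `B·z`). -/
theorem tiltCalibration_of_topScale (hoff : OffCellNegligible) (hloc : PrimeCellLocalisation)
    (htop : TopScalePrimeCofactorLaw) : TiltCalibration := by
  intro k f hf θ hθ hθ' ε hε
  obtain ⟨B, hB⟩ := hloc k f hf θ hθ hθ'
  obtain ⟨z₁, hz₁, h₁⟩ := hB θ hθ le_rfl
  obtain ⟨z₂, hz₂, h₂⟩ := htop k f hf θ hθ hθ' θ hθ le_rfl (ε / 3) (by positivity)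
  obtain ⟨z₃, hz₃, h₃⟩ := hoff k f hf θ hθ hθ' (ε / 3) (by positivity)
  set z₄ : ℝ := ε / (3 * (|B| + 1)) with hz₄def
  have hz₄ : 0 < z₄ := by positivity
  refine ⟨min (min z₁ z₂) (min z₃ z₄), lt_min (lt_min hz₁ hz₂) (lt_min hz₃ hz₄), fun z hz hzlt => ?_⟩
  have hzz₁ : z < z₁ := lt_of_lt_of_le hzlt ((min_le_left _ _).trans (min_le_left _ _))
  have hzz₂ : z < z₂ := lt_of_lt_of_le hzlt ((min_le_left _ _).trans (min_le_right _ _))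
  have hzz₃ : z < z₃ := lt_of_lt_of_le hzlt ((min_le_right _ _).trans (min_le_left _ _))
  have hzz₄ : z < z₄ := lt_of_lt_of_le hzlt ((min_le_right _ _).trans (min_le_right _ _))
  have H₁ := h₁ z hz hzz₁
  have H₂ := h₂ z hz hzz₂
  have H₃ := h₃ z hz hzz₃
  simp only at H₁ H₂ H₃ ⊢
  have hlog : Real.log (θ / θ) = 0 := by rw [div_self hθ.ne', Real.log_one]
  rw [hlog, add_zero, mul_one] at H₁
  -- B * z ≤ ε / 3
  have hBz : B * z ≤ ε / 3 := by
    have h1 : B * z ≤ |B| * z := mul_le_mul_of_nonneg_right (le_abs_self B) hz.le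
    have h2 : |B| * z ≤ |B| * z₄ := mul_le_mul_of_nonneg_left hzz₄.le (abs_nonneg B)
    have h3 : |B| * z₄ ≤ ε / 3 := by
      rw [hz₄def]
      have hpos : 0 < 3 * (|B| + 1) := by positivity
      rw [mul_div_assoc']
      rw [div_le_div_iff₀ hpos (by norm_num : (0:ℝ) < 3)]
      nlinarith [abs_nonneg B, hε]
    linarith
  filter_upwards [H₁, H₂, H₃] with x hx₁ hx₂ hx₃
  -- split the full sum: cell + off-cell, cell = loc + nonloc
  have hsplit := Finset.sum_filter_add_sum_filter_not (Finset.Icc 1 x)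
    (fun n : ℕ => cellPred f θ x n)
    (fun n : ℕ => z ^ (∑ i, ArithmeticFunction.cardDistinctFactors (((f i).eval (n : ℤ)).toNat)))
  have hsplit2 := Finset.sum_filter_add_sum_filter_not ((Finset.Icc 1 x).filter (fun n : ℕ => cellPred f θ x n))
    (fun n : ℕ => locPred f θ θ x n)
    (fun n : ℕ => z ^ (∑ i, ArithmeticFunction.cardDistinctFactors (((f i).eval (n : ℤ)).toNat)))
  rw [← hsplit, ← hsplit2]
  set S₁ := ∑ n ∈ ((Finset.Icc 1 x).filter (fun n : ℕ => cellPred f θ x n)).filter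
      (fun n : ℕ => locPred f θ θ x n),
    z ^ (∑ i, ArithmeticFunction.cardDistinctFactors (((f i).eval (n : ℤ)).toNat)) with hS₁
  set S₂ := ∑ n ∈ ((Finset.Icc 1 x).filter (fun n : ℕ => cellPred f θ x n)).filter
      (fun n : ℕ => ¬ locPred f θ θ x n),
    z ^ (∑ i, ArithmeticFunction.cardDistinctFactors (((f i).eval (n : ℤ)).toNat)) with hS₂
  set S₃ := ∑ n ∈ (Finset.Icc 1 x).filter (fun n : ℕ => ¬ cellPred f θ x n),
    z ^ (∑ i, ArithmeticFunction.cardDistinctFactors (((f i).eval (n : ℤ)).toNat)) with hS₃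
  set L := Real.log x ^ k with hL
  set V := ∏ p ∈ (Finset.range ⌊(x : ℝ) ^ θ⌋₊).filter Nat.Prime,
    ((p : ℝ) - Literature.NumberTheory.Sieve.polyRootCountMod f p) /
      ∑ s ∈ Finset.range p, z ^ (Finset.univ.filter (fun i => (p : ℤ) ∣ (f i).eval (s : ℤ))).card with hV
  set D := z ^ k * (x : ℝ) with hD
  set C := Literature.NumberTheory.Sieve.batemanHornConst f / ∏ i, ((f i).natDegree : ℝ) with hC
  have key : L * (S₁ + S₂ + S₃) * V / D - C = (L * S₁ * V / D - C) + L * S₂ * V / D + L * S₃ * V / D := by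
    ring
  rw [key]
  calc |L * S₁ * V / D - C + L * S₂ * V / D + L * S₃ * V / D|
      ≤ |L * S₁ * V / D - C + L * S₂ * V / D| + |L * S₃ * V / D| := abs_add_le _ _
    _ ≤ (|L * S₁ * V / D - C| + |L * S₂ * V / D|) + |L * S₃ * V / D| := by
        gcongr; exact abs_add_le _ _
    _ ≤ (ε / 3 + ε / 3) + ε / 3 := add_le_add (add_le_add hx₂ (hx₁.trans hBz)) hx₃
    _ = ε := by ring

/-- PROVED converse glue (ε/3): the crux + off-cell bound + localisation ⇒ the top-scale core for EVERY
cofactor exponent `ε₀ ∈ (0, θ]`. Hence, modulo the two provable lemmas, `TiltCalibration ⇔ TopScalePrimeCofactorLaw`. -/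
theorem topScale_of_tiltCalibration (hoff : OffCellNegligible) (hloc : PrimeCellLocalisation)
    (h : TiltCalibration) : TopScalePrimeCofactorLaw := by
  intro k f hf θ hθ hθ' ε₀ hε₀ hε₀θ ε hε
  obtain ⟨B, hB⟩ := hloc k f hf θ hθ hθ'
  obtain ⟨z₁, hz₁, h₁⟩ := hB ε₀ hε₀ hε₀θ
  obtain ⟨z₂, hz₂, h₂⟩ := h k f hf θ hθ hθ' (ε / 3) (by positivity)
  obtain ⟨z₃, hz₃, h₃⟩ := hoff k f hf θ hθ hθ' (ε / 3) (by positivity)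
  have hlog0 : 0 ≤ Real.log (θ / ε₀) := Real.log_nonneg ((one_le_div hε₀).mpr hε₀θ)
  set M : ℝ := 1 + Real.log (θ / ε₀) with hMdef
  have hM : 1 ≤ M := by rw [hMdef]; linarith
  have hM0 : 0 < M := by linarith
  set z₄ : ℝ := ε / (3 * (|B| + 1) * M) with hz₄def
  have hz₄ : 0 < z₄ := by positivity
  refine ⟨min (min z₁ z₂) (min z₃ z₄), lt_min (lt_min hz₁ hz₂) (lt_min hz₃ hz₄), fun z hz hzlt => ?_⟩
  have hzz₁ : z < z₁ := lt_of_lt_of_le hzlt ((min_le_left _ _).trans (min_le_left _ _))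
  have hzz₂ : z < z₂ := lt_of_lt_of_le hzlt ((min_le_left _ _).trans (min_le_right _ _))
  have hzz₃ : z < z₃ := lt_of_lt_of_le hzlt ((min_le_right _ _).trans (min_le_left _ _))
  have hzz₄ : z < z₄ := lt_of_lt_of_le hzlt ((min_le_right _ _).trans (min_le_right _ _))
  have H₁ := h₁ z hz hzz₁
  have H₂ := h₂ z hz hzz₂
  have H₃ := h₃ z hz hzz₃
  simp only at H₁ H₂ H₃ ⊢
  -- B * z * M ≤ ε / 3
  have hBz : B * z * M ≤ ε / 3 := by
    have h1 : B * z * M ≤ |B| * z * M :=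
      mul_le_mul_of_nonneg_right (mul_le_mul_of_nonneg_right (le_abs_self B) hz.le) hM0.le
    have h2 : |B| * z * M ≤ |B| * z₄ * M :=
      mul_le_mul_of_nonneg_right (mul_le_mul_of_nonneg_left hzz₄.le (abs_nonneg B)) hM0.le
    have h3 : |B| * z₄ * M ≤ ε / 3 := by
      rw [hz₄def]
      have hpos : 0 < 3 * (|B| + 1) * M := by positivity
      have : |B| * (ε / (3 * (|B| + 1) * M)) * M = (|B| * M * ε) / (3 * (|B| + 1) * M) := by ring
      rw [this, div_le_div_iff₀ hpos (by norm_num : (0:ℝ) < 3)]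
      nlinarith [abs_nonneg B, hε, hM0, mul_nonneg (abs_nonneg B) hM0.le]
    linarith
  filter_upwards [H₁, H₂, H₃] with x hx₁ hx₂ hx₃
  have hsplit := Finset.sum_filter_add_sum_filter_not (Finset.Icc 1 x)
    (fun n : ℕ => cellPred f θ x n)
    (fun n : ℕ => z ^ (∑ i, ArithmeticFunction.cardDistinctFactors (((f i).eval (n : ℤ)).toNat)))
  have hsplit2 := Finset.sum_filter_add_sum_filter_not ((Finset.Icc 1 x).filter (fun n : ℕ => cellPred f θ x n))
    (fun n : ℕ => locPred f θ ε₀ x n)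
    (fun n : ℕ => z ^ (∑ i, ArithmeticFunction.cardDistinctFactors (((f i).eval (n : ℤ)).toNat)))
  rw [← hsplit, ← hsplit2] at hx₂
  set S₁ := ∑ n ∈ ((Finset.Icc 1 x).filter (fun n : ℕ => cellPred f θ x n)).filter
      (fun n : ℕ => locPred f θ ε₀ x n),
    z ^ (∑ i, ArithmeticFunction.cardDistinctFactors (((f i).eval (n : ℤ)).toNat)) with hS₁
  set S₂ := ∑ n ∈ ((Finset.Icc 1 x).filter (fun n : ℕ => cellPred f θ x n)).filter
      (fun n : ℕ => ¬ locPred f θ ε₀ x n),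
    z ^ (∑ i, ArithmeticFunction.cardDistinctFactors (((f i).eval (n : ℤ)).toNat)) with hS₂
  set S₃ := ∑ n ∈ (Finset.Icc 1 x).filter (fun n : ℕ => ¬ cellPred f θ x n),
    z ^ (∑ i, ArithmeticFunction.cardDistinctFactors (((f i).eval (n : ℤ)).toNat)) with hS₃
  set L := Real.log x ^ k with hL
  set V := ∏ p ∈ (Finset.range ⌊(x : ℝ) ^ θ⌋₊).filter Nat.Prime,
    ((p : ℝ) - Literature.NumberTheory.Sieve.polyRootCountMod f p) /
      ∑ s ∈ Finset.range p, z ^ (Finset.univ.filter (fun i => (p : ℤ) ∣ (f i).eval (s : ℤ))).card with hV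
  set D := z ^ k * (x : ℝ) with hD
  set C := Literature.NumberTheory.Sieve.batemanHornConst f / ∏ i, ((f i).natDegree : ℝ) with hC
  have key : L * S₁ * V / D - C = (L * (S₁ + S₂ + S₃) * V / D - C) - L * S₂ * V / D - L * S₃ * V / D := by
    ring
  rw [key]
  calc |L * (S₁ + S₂ + S₃) * V / D - C - L * S₂ * V / D - L * S₃ * V / D|
      ≤ |L * (S₁ + S₂ + S₃) * V / D - C - L * S₂ * V / D| + |L * S₃ * V / D| := abs_sub _ _
    _ ≤ (|L * (S₁ + S₂ + S₃) * V / D - C| + |L * S₂ * V / D|) + |L * S₃ * V / D| := by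
        gcongr; exact abs_sub _ _
    _ ≤ (ε / 3 + ε / 3) + ε / 3 := add_le_add (add_le_add hx₂ (hx₁.trans hBz)) hx₃
    _ = ε := by ring

/-! ## §2 The order dichotomy in `z` -/

/-- PROVABLE (L), refined Nair–Tenenbaum/Henriot: the calibrated tilted mass is BOUNDED, `Φ_x(z) ≤ B(f, θ)`
for all small `z`, eventually in `x` (each `fᵢ(n)` with non-trivial rough part costs a factor `z`, which
supplies the `z^k` the plain class-`M` bound `Σ_n z^{Σω(fᵢ(n))} ≪ x(log x)^{k(z-1)}` lacks; smooth values by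
Rankin). This is the upper half of the ORDER statement; it is all that `PrimeCellLocalisation` and
`OffCellNegligible` need. -/
def TiltedMassOrderUpper : Prop :=
  ∀ (k : ℕ) (f : Fin k → Polynomial ℤ), Literature.NumberTheory.Sieve.IsBatemanHornSystem f →
    ∀ θ : ℝ, 0 < θ → θ ≤ 1 / 4 → ∃ B z₂ : ℝ, 0 < z₂ ∧ ∀ z : ℝ, 0 < z → z < z₂ →
      let w : ℕ → ℝ := fun n => z ^ (∑ i, ArithmeticFunction.cardDistinctFactors (((f i).eval (n : ℤ)).toNat))
      let cnt : ℕ → ℕ → ℕ := fun p s => (Finset.univ.filter (fun i => (p : ℤ) ∣ (f i).eval (s : ℤ))).card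
      let m : ℕ → ℝ := fun p => ∑ s ∈ Finset.range p, z ^ cnt p s
      let V : ℕ → ℝ := fun x => ∏ p ∈ (Finset.range ⌊(x : ℝ) ^ θ⌋₊).filter Nat.Prime,
        ((p : ℝ) - Literature.NumberTheory.Sieve.polyRootCountMod f p) / m p
      ∀ᶠ x : ℕ in atTop, Real.log x ^ k * (∑ n ∈ Finset.Icc 1 x, w n) * V x / (z ^ k * (x : ℝ)) ≤ B

/-- PROVABLE (M/L), two-sided fundamental lemma on the tilted smooth parts: the calibrated tilted mass is at
least `c·z^r` for some exponent `r = r(f)` (crudely `r ≍ k·Σdeg/θ'`; plausibly `r = Σᵢ (rᵢ − 1)` if weighted-sieve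
almost-prime input is made uniform over the `x^{o(1)}`-divided family, e.g. `r = 1` for `X²+1` from Iwaniec's `n²+1 = P₂` — the tilted
smooth parts, not the almost-prime count, supply the `(log x)^{kz}`). Record §1(b): the gap
between `z^r` here and the constant in the crux is EXACTLY the prime cell. -/
def TiltedMassOrderLowerCrude : Prop :=
  ∀ (k : ℕ) (f : Fin k → Polynomial ℤ), Literature.NumberTheory.Sieve.IsBatemanHornSystem f →
    ∀ θ : ℝ, 0 < θ → θ ≤ 1 / 4 → ∃ r : ℕ, ∃ c z₂ : ℝ, 0 < c ∧ 0 < z₂ ∧ ∀ z : ℝ, 0 < z → z < z₂ →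
      let w : ℕ → ℝ := fun n => z ^ (∑ i, ArithmeticFunction.cardDistinctFactors (((f i).eval (n : ℤ)).toNat))
      let cnt : ℕ → ℕ → ℕ := fun p s => (Finset.univ.filter (fun i => (p : ℤ) ∣ (f i).eval (s : ℤ))).card
      let m : ℕ → ℝ := fun p => ∑ s ∈ Finset.range p, z ^ cnt p s
      let V : ℕ → ℝ := fun x => ∏ p ∈ (Finset.range ⌊(x : ℝ) ^ θ⌋₊).filter Nat.Prime,
        ((p : ℝ) - Literature.NumberTheory.Sieve.polyRootCountMod f p) / m p
      ∀ᶠ x : ℕ in atTop, c * z ^ r ≤ Real.log x ^ k * (∑ n ∈ Finset.Icc 1 x, w n) * V x / (z ^ k * (x : ℝ))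

/-- THE ORDER STATEMENT (weaker than the crux, already summit-class for `Σdeg ≥ 2`): the calibrated tilted
mass stays above a POSITIVE constant uniformly as `z → 0⁺` — i.e. `Σ_{n≤x} z^{Σω(fᵢ(n))} ≍ z^k·x(log x)^{k(z-1)}`
with the factor `z^k` and not a higher power. By the cell bookkeeping this is the statement that the prime
cell carries a positive share of the tilted mass: order-of-magnitude production of `fᵢ(n) = (cofactor)·prime`
with cofactor `≤ x^{ε₀}` for `≫ x(log x)^{k(z-1)}` integers (record §1(b); strategist `PrimeCellLowerBound`). -/
def PrimeCellPositiveShare : Prop :=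
  ∀ (k : ℕ) (f : Fin k → Polynomial ℤ), Literature.NumberTheory.Sieve.IsBatemanHornSystem f →
    ∀ θ : ℝ, 0 < θ → θ ≤ 1 / 4 → ∃ c₀ z₂ : ℝ, 0 < c₀ ∧ 0 < z₂ ∧ ∀ z : ℝ, 0 < z → z < z₂ →
      let w : ℕ → ℝ := fun n => z ^ (∑ i, ArithmeticFunction.cardDistinctFactors (((f i).eval (n : ℤ)).toNat))
      let cnt : ℕ → ℕ → ℕ := fun p s => (Finset.univ.filter (fun i => (p : ℤ) ∣ (f i).eval (s : ℤ))).card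
      let m : ℕ → ℝ := fun p => ∑ s ∈ Finset.range p, z ^ cnt p s
      let V : ℕ → ℝ := fun x => ∏ p ∈ (Finset.range ⌊(x : ℝ) ^ θ⌋₊).filter Nat.Prime,
        ((p : ℝ) - Literature.NumberTheory.Sieve.polyRootCountMod f p) / m p
      ∀ᶠ x : ℕ in atTop, c₀ ≤ Real.log x ^ k * (∑ n ∈ Finset.Icc 1 x, w n) * V x / (z ^ k * (x : ℝ))

/-- PROVED: the crux forces the order statement with `c₀ = C(f)/(2 ∏ deg fᵢ) > 0` (uses `C(f) > 0` from
`IsBatemanHornSystem.hasBatemanHornConst_holds` and `deg fᵢ ≥ 1`). -/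
theorem primeCellPositiveShare_of (h : TiltCalibration) : PrimeCellPositiveShare := by
  intro k f hf θ hθ hθ'
  set C := Literature.NumberTheory.Sieve.batemanHornConst f / ∏ i, ((f i).natDegree : ℝ) with hC
  have hCpos : 0 < C := by
    have h1 : 0 < Literature.NumberTheory.Sieve.batemanHornConst f :=
      (Literature.NumberTheory.Sieve.IsBatemanHornSystem.hasBatemanHornConst_holds hf).2
    have h2 : 0 < ∏ i, ((f i).natDegree : ℝ) := by
      refine Finset.prod_pos fun i _ => ?_
      exact_mod_cast hf.natDegree_pos i
    exact div_pos h1 h2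
  obtain ⟨z₂, hz₂, h₂⟩ := h k f hf θ hθ hθ' (C / 2) (by positivity)
  refine ⟨C / 2, z₂, by positivity, hz₂, fun z hz hzlt => ?_⟩
  have H := h₂ z hz hzlt
  simp only at H ⊢
  filter_upwards [H] with x hx
  have e1 := (abs_le.mp hx).1
  linarith

/-! ## §3 The `X²+1` unpacking at the conjectural endpoint exponent -/

/-- HARDNESS CERTIFICATE at the first nonlinear member, sharpened to the top scale (strategist
`LargePrimeFactorThreeHalves` had exponent `3/2`): `PrimeCellPositiveShare` + `PrimeCellLocalisation` at
cofactor exponent `ε₀ = η/2` + Mertens for `V ≍ (θ log x)^{-z}` give, for every `η > 0` and every small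
`z > 0`, eventually `#{n ≤ x : some prime p ≥ x^{2-η} divides n²+1} ≥ c·x·(log x)^{z-1}`. Print reaches
`P⁺(n²+1) > n^{1.3}` infinitely often (Pascadi, Forum Math. Pi 2026, arXiv:2404.04239); exponent `2 − η` for
every `η` with this multiplicity is the conjectural endpoint of the Chebyshev–Hooley problem. Typed only. -/
def LargePrimeFactorTopScale : Prop :=
  ∀ η : ℝ, 0 < η → ∃ z₂ : ℝ, 0 < z₂ ∧ ∀ z : ℝ, 0 < z → z < z₂ → ∃ c : ℝ, 0 < c ∧
    ∀ᶠ x : ℕ in atTop,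
      c * (x : ℝ) * Real.log x ^ (z - 1) ≤
        (((Finset.Icc 1 x).filter (fun n : ℕ =>
            ∃ p : ℕ, p ∈ (n ^ 2 + 1).primeFactors ∧ (x : ℝ) ^ (2 - η) ≤ (p : ℝ))).card : ℝ)

end Summit.Parity.BatemanHorn.Cruxes.TiltCalibration.Ideator1

end
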